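import Literature.Computability.Cryptography.HallgrenClassGroupOrderInj
import Literature.NumberTheory.QuadraticFields.FormIdealsStructure
import HarnessLib

/-!
# The order of conductor `f` inside the maximal order of a quadratic field: the embedding
# `ι : O_{f² d_K} → 𝓞 K` and ideals prime to the conductor (Cox, Prop. 7.20)

Topic `NumberTheory/QuadraticFields`, namespace `Literature.NumberTheory.QuadraticFields.RingClass`.
Everything here is PROVED (theorems only, no definitions, no named facts).

Let `K` be a quadratic field with integral basis `(1, ω)`, `ω² = m + tω` (so `d_K = t² + 4m`,
`HeegnerCondition.discr_eq_sq_add_four_mul`), let `f ≥ 1` and let `O_D`, `D = f² (t² + 4m)`, be the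
tree's abstract quadratic order `OrderCl.QO Δ = ℤ[ω_D]`, `ω_D² = m(D) + D ω_D`
(`HallgrenClassGroupOrder.lean`). We construct the ring embedding
`ι : O_D → 𝓞 K`, `ω_D ↦ f ω + s`, `2s = D − f t` (so `ι(ω_D) = (D + f√d_K)/2`), whose image is the
order `ℤ + f 𝓞 K` of conductor `f` (Cox §7.A, Lemma 7.2), and prove Cox's Prop. 7.20: on ideals prime
to `f` the maps `𝔄 ↦ 𝔄 ∩ O` (`Ideal.comap ι`) and `𝔟 ↦ 𝔟 𝓞 K` (`Ideal.map ι`) are mutually inverse.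

* `exists_ringHom` — the embedding exists (`QuadraticAlgebra.lift`);
* `emb_apply`, `emb_injective`, `mem_range_iff`, `natCast_mul_mem_range` — `ι(x + y ω_D) = (x + ys) + f y ω`,
  `range ι = {z : f ∣ ω-coordinate of z} ⊇ f 𝓞 K`;
* `exists_sub_intCast_mem_conductor` — every element of `O` is `≡` an integer modulo the conductor
  `𝔣' = ι⁻¹(f 𝓞 K)`;
* `map_comap_eq` — **Cox, Prop. 7.20**: `(𝔄 ∩ O) 𝓞 K = 𝔄` for `𝔄 + f𝓞 K = 𝓞 K`;
* `comap_map_eq` — **Cox, Prop. 7.20**: `𝔟 𝓞 K ∩ O = 𝔟` for `𝔟 + 𝔣' = O`.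

## References

* D. A. Cox, *Primes of the form x² + ny²*, 2nd ed., Wiley (2013), §7.A Lemma 7.2, §7.C Lemma 7.18,
  Prop. 7.20 (PDF pp. 149–160 of the held copy). [cite: Cox2013, §7.C Prop. 7.20]

## Mathlib / tree search

Tree: `OrderCl.QO`, `qbasis`, `qbasis_zero`, `qbasis_rel` (`HallgrenClassGroupOrder`); `mOf`,
`four_mul_mOf` (`HallgrenClassGroupFormComposition`); `Quadratic.eq_repr_add_repr_mul_of_basis`,
`repr_intCast_add_intCast_mul_zero/one` (`FormIdeals`); the special case conductor `∣ 2`,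
`𝒪 = ℤ[√−p]` is `Csidh.map_comap_eq_of_odd_mem`, `comap_map_eq_of_sup_eq_top`
(`CsidhGeneratorsOrder`). Mathlib: `QuadraticAlgebra.lift`, `Ideal.map`, `Ideal.comap`,
`Ideal.map_comap_le`, `Ideal.le_comap_map`.
-/

noncomputable section

open scoped QuadraticAlgebra
open Module NumberField QuadraticAlgebra
open Literature.Computability.Cryptography.Hallgren2005
open Literature.Computability.Cryptography.Hallgren2005.OrderCl
open Literature.Computability.Cryptography.Hallgren2005.FormComposition (mOf four_mul_mOf)
open Literature.NumberTheory.QuadraticFields.Quadratic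

namespace Literature.NumberTheory.QuadraticFields.RingClass

variable {K : Type*} [Field K]
variable (b : Basis (Fin 2) ℤ (𝓞 K)) (hb : b 0 = 1) {t m : ℤ}
  (hω : b 1 * b 1 = (m : 𝓞 K) + (t : 𝓞 K) * b 1)
variable {f : ℕ} {Δ : NegDiscr} {s : ℤ}
  (hD : Δ.D = (f : ℤ) ^ 2 * (t ^ 2 + 4 * m)) (hs : 2 * s = Δ.D - f * t)

/-! ### The embedding `ι : O_D → 𝓞 K`, `ω_D ↦ f ω + s` -/

include hD in
/-- `D = f² d_K ≡ 0, 1 (mod 4)`. [cite: Cox2013, §7.A (7.3) (the discriminant f²d_K of the order of conductor f)] -/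
theorem emod_four_of_eq : Δ.D % 4 = 0 ∨ Δ.D % 4 = 1 := by
  rw [hD]
  rcases Int.even_or_odd ((f : ℤ) * t) with ⟨r, hr⟩ | ⟨r, hr⟩
  · left
    have : (f : ℤ) ^ 2 * (t ^ 2 + 4 * m) = 4 * (r ^ 2 + (f : ℤ) ^ 2 * m) := by
      have h1 : ((f : ℤ) * t) ^ 2 = (r + r) ^ 2 := by rw [hr]
      linear_combination h1
    omega
  · right
    have : (f : ℤ) ^ 2 * (t ^ 2 + 4 * m) = 4 * (r ^ 2 + r + (f : ℤ) ^ 2 * m) + 1 := by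
      have h1 : ((f : ℤ) * t) ^ 2 = (2 * r + 1) ^ 2 := by rw [hr]
      linear_combination h1
    omega

include hD in
/-- `2 ∣ D − f t` (so the integer `s` with `2 s = D − f t` exists). [cite: Cox2013, §7.A Lemma 7.2] -/
theorem two_dvd_sub : (2 : ℤ) ∣ Δ.D - f * t := by
  rw [hD]
  rcases Int.even_or_odd ((f : ℤ) * t) with ⟨r, hr⟩ | ⟨r, hr⟩
  · refine ⟨2 * r ^ 2 + 2 * (f : ℤ) ^ 2 * m - r, ?_⟩
    have h1 : ((f : ℤ) * t) ^ 2 = (r + r) ^ 2 := by rw [hr]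
    linear_combination h1 - hr
  · refine ⟨2 * r ^ 2 + r + 2 * (f : ℤ) ^ 2 * m, ?_⟩
    have h1 : ((f : ℤ) * t) ^ 2 = (2 * r + 1) ^ 2 := by rw [hr]
    linear_combination h1 - hr

include hD hs in
/-- The constant term of the quadratic relation of `u = fω + s`: `s² + f² m = m(D) + D s`. [cite: Cox2013, §7.A Lemma 7.2] -/
theorem sq_add_eq : s ^ 2 + (f : ℤ) ^ 2 * m = mOf Δ.D + Δ.D * s := by
  have h4 := four_mul_mOf (emod_four_of_eq hD)
  have h : 4 * (s ^ 2 + (f : ℤ) ^ 2 * m) = 4 * (mOf Δ.D + Δ.D * s) := by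
    linear_combination (2 * s - Δ.D - f * t) * hs - h4 - hD
  omega

include hω hD hs in
/-- `u = f ω + s` satisfies `u² = m(D) + D u` in `𝓞 K`. [cite: Cox2013, §7.A Lemma 7.2] -/
theorem emb_root_rel :
    ((f : 𝓞 K) * b 1 + (s : 𝓞 K)) * ((f : 𝓞 K) * b 1 + (s : 𝓞 K)) =
      (mOf Δ.D) • (1 : 𝓞 K) + Δ.D • ((f : 𝓞 K) * b 1 + (s : 𝓞 K)) := by
  have h1 := congrArg (Int.cast : ℤ → 𝓞 K) (sq_add_eq hD hs)
  have h2 := congrArg (Int.cast : ℤ → 𝓞 K) hs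
  push_cast at h1 h2
  rw [zsmul_eq_mul, mul_one, zsmul_eq_mul]
  linear_combination ((f : 𝓞 K)) ^ 2 * hω + h1 + (f : 𝓞 K) * b 1 * h2

include hω hD hs in
/-- **The embedding of the order of conductor `f`**: a ring homomorphism `ι : O_D → 𝓞 K` with
`ι(ω_D) = f ω + s`. [cite: Cox2013, §7.A Lemma 7.2] -/
theorem exists_ringHom : ∃ ι : QO Δ →+* 𝓞 K, ι ω = (f : 𝓞 K) * b 1 + (s : 𝓞 K) := by
  refine ⟨(QuadraticAlgebra.lift ⟨(f : 𝓞 K) * b 1 + (s : 𝓞 K), emb_root_rel b hω hD hs⟩).toRingHom, ?_⟩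
  change QuadraticAlgebra.lift _ ω = _
  rw [QuadraticAlgebra.lift_apply_apply]
  simp [omega_re, omega_im]

variable (ι : QO Δ →+* 𝓞 K) (hι : ι ω = (f : 𝓞 K) * b 1 + (s : 𝓞 K))

include hι in
/-- `ι(x + y ω_D) = (x + y s) + (f y) ω`. [cite: Cox2013, §7.A Lemma 7.2 (𝒪 = ℤ + f𝒪_K)] -/
theorem emb_apply (z : QO Δ) :
    ι z = ((z.re + z.im * s : ℤ) : 𝓞 K) + ((f * z.im : ℤ) : 𝓞 K) * b 1 := by
  obtain ⟨x, y⟩ := z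
  show ι ⟨x, y⟩ = ((x + y * s : ℤ) : 𝓞 K) + ((f * y : ℤ) : 𝓞 K) * b 1
  rw [mk_eq_add_smul_omega x y, map_add, map_zsmul, hι, algebraMap_int_eq, eq_intCast, map_intCast,
    zsmul_eq_mul]
  push_cast
  ring

include hb hι in
/-- The `ω`-coordinate of `ι z` is `f · im z`. [cite: Cox2013, §7.A Lemma 7.2 (𝒪 = ℤ + f𝒪_K)] -/
theorem repr_emb_one (z : QO Δ) : b.repr (ι z) 1 = f * z.im := by
  rw [emb_apply b ι hι z, repr_intCast_add_intCast_mul_one b hb]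

include hb hι in
/-- The `1`-coordinate of `ι z` is `re z + s · im z`. [cite: Cox2013, §7.A Lemma 7.2 (𝒪 = ℤ + f𝒪_K)] -/
theorem repr_emb_zero (z : QO Δ) : b.repr (ι z) 0 = z.re + z.im * s := by
  rw [emb_apply b ι hι z, repr_intCast_add_intCast_mul_zero b hb]

include hb hι in
/-- `ι` is injective (for `f ≠ 0`). [cite: Cox2013, §7.A Lemma 7.2 (𝒪 = ℤ + f𝒪_K)] -/
theorem emb_injective (hf : f ≠ 0) : Function.Injective ι := by
  intro z w h
  have h1 := repr_emb_one b hb ι hι z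
  have h0 := repr_emb_zero b hb ι hι z
  rw [h, repr_emb_one b hb ι hι w] at h1
  rw [h, repr_emb_zero b hb ι hι w] at h0
  have him : z.im = w.im := by
    have : (f : ℤ) * z.im = f * w.im := h1.symm
    exact mul_left_cancel₀ (by exact_mod_cast hf) this
  ext
  · rw [him] at h0; linarith
  · exact him

include hb hι in
/-- **The image of `ι` is `ℤ + f 𝓞 K`**: `z ∈ range ι` iff `f` divides the `ω`-coordinate of `z`.
[cite: Cox2013, §7.A Lemma 7.2] -/
theorem mem_range_iff (z : 𝓞 K) : z ∈ Set.range ι ↔ (f : ℤ) ∣ b.repr z 1 := by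
  constructor
  · rintro ⟨w, rfl⟩
    exact ⟨w.im, repr_emb_one b hb ι hι w⟩
  · rintro ⟨y, hy⟩
    refine ⟨⟨b.repr z 0 - y * s, y⟩, ?_⟩
    rw [emb_apply b ι hι]
    conv_rhs => rw [eq_repr_add_repr_mul_of_basis b hb z, hy]
    push_cast
    ring

/-- Integers are in the image of `ι`. [cite: Cox2013, §7.A Lemma 7.2 (𝒪 = ℤ + f𝒪_K)] -/
theorem intCast_mem_range (n : ℤ) : (n : 𝓞 K) ∈ Set.range ι :=
  ⟨n, by simp [map_intCast]⟩

include hb hι in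
/-- **The conductor**: `f · z ∈ range ι` for every `z ∈ 𝓞 K`. [cite: Cox2013, §7.A Lemma 7.2] -/
theorem natCast_mul_mem_range (z : 𝓞 K) : (f : 𝓞 K) * z ∈ Set.range ι := by
  rw [mem_range_iff b hb ι hι]
  refine ⟨b.repr z 1, ?_⟩
  have : (f : 𝓞 K) * z = (f : ℤ) • z := by simp
  rw [this, map_zsmul, Finsupp.smul_apply, smul_eq_mul]

include hb hι in
/-- Every element of `f 𝓞 K` is in the image of `ι`. [cite: Cox2013, §7.A Lemma 7.2 (f𝒪_K ⊆ 𝒪)] -/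
theorem mem_range_of_mem_span (z : 𝓞 K) (hz : z ∈ Ideal.span {(f : 𝓞 K)}) : z ∈ Set.range ι := by
  obtain ⟨w, rfl⟩ := Ideal.mem_span_singleton'.1 hz
  rw [mul_comm]
  exact natCast_mul_mem_range b hb ι hι w

include hι in
/-- **Every element of `O` is congruent to an integer modulo the conductor** `𝔣' = ι⁻¹(f𝓞 K)`:
`z − (re z + s·im z) ∈ 𝔣'`. [cite: Cox2013, §7.A Lemma 7.2] -/
theorem sub_intCast_mem_conductor (z : QO Δ) :
    z - ((z.re + z.im * s : ℤ) : QO Δ) ∈ (Ideal.span {(f : 𝓞 K)}).comap ι := by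
  rw [Ideal.mem_comap, map_sub, map_intCast, emb_apply b ι hι]
  refine Ideal.mem_span_singleton'.2 ⟨(z.im : 𝓞 K) * b 1, ?_⟩
  push_cast
  ring

/-! ### Cox, Prop. 7.20: `map` and `comap` on ideals prime to the conductor -/

include hb hι in
/-- **Cox, Prop. 7.20 (first half)**: for an ideal `𝔄` of `𝓞 K` with `𝔄 + f 𝓞 K = 𝓞 K`,
`(𝔄 ∩ O) · 𝓞 K = 𝔄`. [cite: Cox2013, §7.C Prop. 7.20] -/
theorem map_comap_eq {𝔄 : Ideal (𝓞 K)} (h𝔄 : 𝔄 ⊔ Ideal.span {(f : 𝓞 K)} = ⊤) :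
    (𝔄.comap ι).map ι = 𝔄 := by
  refine le_antisymm Ideal.map_comap_le ?_
  intro x hx
  obtain ⟨α, hα, γ, hγ, h1⟩ := Submodule.mem_sup.1 (h𝔄 ▸ Submodule.mem_top (x := (1 : 𝓞 K)))
  obtain ⟨γ', rfl⟩ := Ideal.mem_span_singleton'.1 hγ
  -- `x = α x + f γ' x`; `α ∈ 𝔄 ∩ range ι` (as `α = 1 − fγ'`), `f x ∈ 𝔄 ∩ range ι`
  have hα' : α ∈ Set.range ι := by
    have : α = 1 - γ' * (f : 𝓞 K) := by rw [← h1]; ring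
    rw [this]
    obtain ⟨w, hw⟩ := natCast_mul_mem_range b hb ι hι γ'
    exact ⟨1 - w, by rw [map_sub, map_one, hw, mul_comm]⟩
  obtain ⟨a, ha⟩ := hα'
  obtain ⟨w, hw⟩ := natCast_mul_mem_range b hb ι hι x
  have hx' : x = ι a * x + γ' * ι w := by rw [ha, hw, ← mul_assoc, ← add_mul, h1, one_mul]
  rw [hx']
  refine Ideal.add_mem _ (Ideal.mul_mem_right _ _ (Ideal.mem_map_of_mem _ ?_))
    (Ideal.mul_mem_left _ _ (Ideal.mem_map_of_mem _ ?_))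
  · rw [Ideal.mem_comap, ha]; exact hα
  · rw [Ideal.mem_comap, hw, mul_comm]; exact Ideal.mul_mem_right _ _ hx

include hb hι in
/-- **Cox, Prop. 7.20 (second half)**: for an ideal `𝔟` of `O` with `𝔟 + 𝔣' = O`
(`𝔣' = ι⁻¹(f 𝓞 K)` the conductor), `(𝔟 · 𝓞 K) ∩ O = 𝔟`. [cite: Cox2013, §7.C Prop. 7.20] -/
theorem comap_map_eq (hf : f ≠ 0) {𝔟 : Ideal (QO Δ)}
    (h𝔟 : 𝔟 ⊔ (Ideal.span {(f : 𝓞 K)}).comap ι = ⊤) : (𝔟.map ι).comap ι = 𝔟 := by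
  refine le_antisymm ?_ Ideal.le_comap_map
  intro z hz
  rw [Ideal.mem_comap] at hz
  obtain ⟨β, hβ, c, hc, h1⟩ := Submodule.mem_sup.1 (h𝔟 ▸ Submodule.mem_top (x := (1 : QO Δ)))
  have hz' : z = z * β + z * c := by rw [← mul_add, h1, mul_one]
  rw [hz']
  refine Ideal.add_mem _ (Ideal.mul_mem_left _ _ hβ) ?_
  -- `ι (z c) ∈ ι(𝔟) 𝓞 K · f ⊆ ι(𝔟)`: write `ι c = f γ`
  rw [Ideal.mem_comap] at hc
  obtain ⟨γ, hγ⟩ := Ideal.mem_span_singleton'.1 hc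
  -- `ι z ∈ span (ι '' 𝔟)`: induction on the span
  have key : ∀ y ∈ (𝔟.map ι), ∀ δ : 𝓞 K, ∃ w ∈ 𝔟, ι w = y * ((f : 𝓞 K) * δ) := by
    intro y hy
    refine Submodule.span_induction ?_ ?_ ?_ ?_ hy
    · rintro _ ⟨v, hv, rfl⟩ δ
      obtain ⟨e, he⟩ := natCast_mul_mem_range b hb ι hι δ
      exact ⟨v * e, Ideal.mul_mem_right _ _ hv, by rw [map_mul, he]⟩
    · intro δ; exact ⟨0, Submodule.zero_mem _, by simp⟩
    · intro y₁ y₂ _ _ h₁ h₂ δ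
      obtain ⟨w₁, hw₁, e₁⟩ := h₁ δ
      obtain ⟨w₂, hw₂, e₂⟩ := h₂ δ
      exact ⟨w₁ + w₂, Ideal.add_mem _ hw₁ hw₂, by rw [map_add, e₁, e₂, add_mul]⟩
    · intro r y _ h δ
      obtain ⟨w, hw, e⟩ := h (r * δ)
      exact ⟨w, hw, by rw [e, smul_eq_mul]; ring⟩
  obtain ⟨w, hw, he⟩ := key (ι z) hz γ
  have : z * c = w := by
    apply emb_injective b hb ι hι hf
    rw [map_mul, he, ← hγ, mul_comm γ]
  rw [this]
  exact hw


/-! ### Integers prime to `f` inside ideals prime to `f` -/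

include hb hω in
/-- **An ideal of `𝓞 K` prime to `f` contains an integer prime to `f`**: if `𝔄 + f𝓞 K = 𝓞 K`, pick
`β ∈ 𝔄` with `β ≡ 1 (mod f)`; then `n = β β̄ = u² + tuv − mv² ∈ 𝔄 ∩ ℤ` and `n ≡ 1 (mod f)`. [cite: Cox2013, §7.C Lemma 7.18 (prime to f iff the norm is prime to f)] -/
theorem exists_intCast_mem_of_sup_eq_top {𝔄 : Ideal (𝓞 K)} (h𝔄 : 𝔄 ⊔ Ideal.span {(f : 𝓞 K)} = ⊤) :
    ∃ n : ℤ, (n : 𝓞 K) ∈ 𝔄 ∧ IsCoprime n f := by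
  obtain ⟨β, hβ, γ, hγ, h1⟩ := Submodule.mem_sup.1 (h𝔄 ▸ Submodule.mem_top (x := (1 : 𝓞 K)))
  obtain ⟨γ', rfl⟩ := Ideal.mem_span_singleton'.1 hγ
  set u : ℤ := b.repr β 0 with hu
  set v : ℤ := b.repr β 1 with hv
  have hβuv : β = (u : 𝓞 K) + (v : 𝓞 K) * b 1 := eq_repr_add_repr_mul_of_basis b hb β
  refine ⟨u ^ 2 + t * u * v - m * v ^ 2, ?_, ?_⟩
  · rw [← add_mul_mul_conj b hω u v, ← hβuv]
    exact Ideal.mul_mem_right _ _ hβ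
  · -- `u = 1 − f γ₀`, `v = −f γ₁`
    have hβ' : β = 1 - (f : ℤ) • γ' := by rw [← h1]; simp; ring
    have hu' : u = 1 - f * b.repr γ' 0 := by
      rw [hu, hβ', map_sub, map_zsmul, ← hb, b.repr_self]; simp
    have hv' : v = -(f * b.repr γ' 1) := by
      rw [hv, hβ', map_sub, map_zsmul, ← hb, b.repr_self]; simp
    rw [hu', hv']
    refine ⟨1, 2 * b.repr γ' 0 - f * (b.repr γ' 0) ^ 2 + t * b.repr γ' 1 - t * f * b.repr γ' 0 * b.repr γ' 1
      + m * f * (b.repr γ' 1) ^ 2, ?_⟩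
    ring

/-! ### Ideals of `O` prime to the conductor are `g · 𝔞_q` with `q` primitive (Cox, Thm. 7.7(i),
Lemma 7.5, Lemma 7.18) -/

include hD in
/-- The form `(A, 2k − D, C)` with `AC = k² − Dk − m(D)` has discriminant `D` and `k(q) = k`. [cite: Cox2013, §7.B Thm. 7.7 and (7.9)] -/
theorem disc_mk_eq {A k C : ℤ} (hn : A * C = k ^ 2 - Δ.D * k - mOf Δ.D) :
    (⟨A, 2 * k - Δ.D, C⟩ : BinQF).disc = Δ.D ∧
      FormComposition.kOf Δ.D ⟨A, 2 * k - Δ.D, C⟩ = k := by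
  have h4 := four_mul_mOf (emod_four_of_eq hD)
  have hdisc : (⟨A, 2 * k - Δ.D, C⟩ : BinQF).disc = Δ.D := by
    rw [BinQF.disc]; dsimp only; linear_combination (-4 : ℤ) * hn + h4
  refine ⟨hdisc, ?_⟩
  rw [FormComposition.kOf]; dsimp only
  omega

include hb hι hD in
/-- **Primitivity from coprimality with the conductor** (Cox, Lemma 7.5 / Lemma 7.18): if the lattice
ideal `(A, ω_D − k)` of `O_D`, `AC = k² − Dk − m(D)`, has `gcd(A, f) = 1`, then the form
`(A, 2k − D, C)` is primitive. Indeed a common divisor `e` of `A, B, C` makes `ι(ω_D − k)/e` an algebraic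
integer, i.e. an element of `𝓞 K`, whose `ω`-coordinate `f/e` forces `e ∣ f`; with `e ∣ A` and
`gcd(A, f) = 1`, `e` is a unit. [cite: Cox2013, §7.A Lemma 7.5 and §7.C Lemma 7.18] -/
theorem isPrimitive_of_isCoprime {A k C : ℤ} (hn : A * C = k ^ 2 - Δ.D * k - mOf Δ.D)
    (hA : IsCoprime A (f : ℤ)) : (⟨A, 2 * k - Δ.D, C⟩ : BinQF).IsPrimitive := by
  rw [BinQF.isPrimitive_iff]
  dsimp only
  intro e heA heB heC
  obtain ⟨A', rfl⟩ := heA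
  obtain ⟨B', hB'⟩ := heB
  obtain ⟨C', rfl⟩ := heC
  have he0 : e ≠ 0 := by
    rintro rfl
    simp only [zero_mul] at hA
    have := (isCoprime_zero_left).1 hA
    -- `f` a unit in `ℤ` with `0 * C = k² - D k - m(D)`… irrelevant: from `IsUnit (f : ℤ)` get `e ∣ f`-free finish
    rw [Int.isUnit_iff] at this
    rcases this with h | h
    · -- f = 1: still fine, but we derive the contradiction differently: `0 = e` divides everything,
      -- in particular `B = 2k - D = 0` and `AC = 0 = k² - Dk - m(D)`; then `D = (2k-D)² - 4AC = 0`,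
      -- contradicting `D < 0`.
      have h0 : (2 * k - Δ.D) = 0 := by simpa using hB'
      have hd : Δ.D = (2 * k - Δ.D) ^ 2 - 4 * (0 * C') := by
        have h4 := four_mul_mOf (emod_four_of_eq hD); nlinarith [hn]
      rw [h0] at hd
      have := Δ.neg
      nlinarith
    · have : (0 : ℤ) ≤ f := by positivity
      omega
  -- `θ = ω_D − k` satisfies `θ² + Bθ + AC = 0`; so `z = ι θ / e` is a root of `X² + B'X + A'C'`
  set θ : QO Δ := ω - (k : QO Δ) with hθ
  have hθrel : θ * θ + ((2 * k - Δ.D : ℤ) : QO Δ) * θ + ((e * A' * (e * C') : ℤ) : QO Δ) = 0 := by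
    have h := sub_mul_sub_eq (qbasis Δ) (qbasis_rel Δ) k
    rw [qbasis_one] at h
    rw [hθ, h, ← hn]
    push_cast
    ring
  have hθrelK : algebraMap (𝓞 K) K (ι θ) * algebraMap (𝓞 K) K (ι θ) +
      (e : K) * (B' : K) * algebraMap (𝓞 K) K (ι θ) + (e : K) ^ 2 * ((A' * C' : ℤ) : K) = 0 := by
    have h := congrArg (fun x : QO Δ => algebraMap (𝓞 K) K (ι x)) hθrel
    simp only [map_add, map_mul, map_intCast, map_zero] at h
    rw [hB'] at h
    push_cast at h ⊢
    linear_combination h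
  have heK : (e : K) ≠ 0 := by
    intro h
    apply he0
    apply intCast_eq_zero_of_basis b hb
    apply RingOfIntegers.coe_injective (K := K)
    rw [map_intCast, map_zero]
    exact h
  set z : K := algebraMap (𝓞 K) K (ι θ) / (e : K) with hz
  have hzint : IsIntegral ℤ z := by
    refine ⟨Polynomial.X ^ 2 + Polynomial.C B' * Polynomial.X + Polynomial.C (A' * C'), ?_, ?_⟩
    · have : (Polynomial.X ^ 2 + Polynomial.C B' * Polynomial.X + Polynomial.C (A' * C') : Polynomial ℤ) =
          Polynomial.X ^ 2 - Polynomial.C (-B') * Polynomial.X - Polynomial.C (-(A' * C')) := by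
        simp only [map_neg]; ring
      rw [this]; exact monic_X_sq_sub _ _
    · simp only [Polynomial.eval₂_add, Polynomial.eval₂_mul, Polynomial.eval₂_pow, Polynomial.eval₂_X,
        Polynomial.eval₂_C]
      simp only [algebraMap_int_eq, eq_intCast, Int.cast_mul]
      rw [hz]
      field_simp
      push_cast at hθrelK ⊢
      linear_combination hθrelK
  obtain ⟨w, hw⟩ := (IsIntegralClosure.isIntegral_iff (A := 𝓞 K)).1 hzint
  -- `e • w = ι θ`, so the `ω`-coordinate `f` of `ι θ` is divisible by `e`
  have hew : (e : 𝓞 K) * w = ι θ := by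
    apply RingOfIntegers.coe_injective
    rw [map_mul, map_intCast, hw, hz]
    field_simp
  have hef : e ∣ (f : ℤ) := by
    have h1 := repr_emb_one b hb ι hι θ
    rw [← hew] at h1
    have h2 : b.repr ((e : 𝓞 K) * w) 1 = e * b.repr w 1 := by
      have : (e : 𝓞 K) * w = (e : ℤ) • w := by simp
      rw [this, map_zsmul, Finsupp.smul_apply, smul_eq_mul]
    rw [h2, hθ] at h1
    simp only [im_sub, omega_im, im_intCast, sub_zero, mul_one] at h1
    exact ⟨b.repr w 1, h1.symm⟩
  -- `e ∣ A = e A'` and `gcd(A, f) = 1` give `e` coprime to `f`; with `e ∣ f`, `e` is a unit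
  have hcop : IsCoprime e (f : ℤ) := hA.of_mul_left_left
  exact hcop.isUnit_of_dvd' (dvd_refl e) hef

include hb hι hD in
/-- **Structure of the ideals of `O` prime to the conductor** (Cox, Thm. 7.7(i) with Lemma 7.18): an
ideal `𝔟` of `O_D` containing an integer `n` prime to `f` is `𝔟 = (g) · 𝔞_q` for an integer `g > 0`
and a primitive positive definite form `q` of discriminant `D` with `gcd(g · a_q, f) = 1`.
[cite: Cox2013, §7.B Thm. 7.7(i) and §7.C Lemma 7.18] -/
theorem exists_eq_span_mul_fIdeal {𝔟 : Ideal (QO Δ)} {n : ℤ} (hn𝔟 : (n : QO Δ) ∈ 𝔟)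
    (hn : IsCoprime n (f : ℤ)) (h𝔟 : 𝔟 ≠ ⊥) :
    ∃ g : ℤ, ∃ q : BinQF, 0 < g ∧ q.IsPosPrim Δ.D ∧ IsCoprime (g * q.a) (f : ℤ) ∧
      𝔟 = Ideal.span {(g : QO Δ)} * fIdeal Δ q := by
  obtain ⟨g, A, k, C, hg, hA, hAC, h𝔟eq⟩ :=
    exists_eq_span_singleton_mul_span_pair (qbasis Δ) (qbasis_zero Δ) (qbasis_rel Δ) h𝔟
  rw [qbasis_one] at h𝔟eq
  obtain ⟨hdisc, hk⟩ := disc_mk_eq hD hAC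
  -- `g A ∣ n`: write `n = g z`, `z = uA + v(ω − k)`, and compare `ω`-coordinates
  have hgA : g * A ∣ n := by
    rw [h𝔟eq] at hn𝔟
    obtain ⟨z, hz, hgz⟩ := Ideal.mem_span_singleton_mul.1 hn𝔟
    rw [← qbasis_one] at hz
    obtain ⟨u, v, rfl⟩ :=
      (mem_span_pair_iff_of_basis (qbasis Δ) (qbasis_zero Δ) (qbasis_rel Δ) hAC _).1 hz
    have h' : ((n : ℤ) : QO Δ) + ((0 : ℤ) : QO Δ) * qbasis Δ 1 =
        ((g * (u * A) - g * v * k : ℤ) : QO Δ) + ((g * v : ℤ) : QO Δ) * qbasis Δ 1 := by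
      rw [← hgz]; push_cast; ring
    obtain ⟨h1, h2⟩ := intCast_add_intCast_mul_inj (qbasis Δ) (qbasis_zero Δ) h'
    have hv : v = 0 := by
      rcases mul_eq_zero.1 h2.symm with h | h
      · exact absurd h hg.ne'
      · exact h
    rw [hv] at h1
    exact ⟨u, by rw [h1]; ring⟩
  have hgAf : IsCoprime (g * A) (f : ℤ) := hn.of_isCoprime_of_dvd_left hgA
  refine ⟨g, ⟨A, 2 * k - Δ.D, C⟩, hg, ⟨hdisc, hA, ?_⟩, hgAf, ?_⟩
  · exact isPrimitive_of_isCoprime b hb hD ι hι hAC hgAf.of_mul_left_right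
  · rw [h𝔟eq, fIdeal, hk]

end Literature.NumberTheory.QuadraticFields.RingClass
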